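import Summits.RiemannHypothesis.RiemannHypothesis.Theses.WeilPos
import Literature.NumberTheory.LFunctions.WeilExplicitProofs
import Literature.NumberTheory.LFunctions.WeilExplicitFormulaProofs
import Literature.NumberTheory.LFunctions.WeilGroundEnergyParitySplit
import Literature.NumberTheory.LFunctions.GeneralizedRH
import Literature.NumberTheory.LFunctions.ZetaRealAxis
import Literature.NumberTheory.LFunctions.UniformWeilPositivityRH
import Summits.RiemannHypothesis.RiemannHypothesis.Theorems.RuelleBandExactFirstBandStubOddSectorCriterion
import Summits.RiemannHypothesis.RiemannHypothesis.Theorems.RuelleBandExactFirstBandStubEvenCriterion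
import HarnessLib

/-!
# Strategist r1 — crux `WeilPos.WeilposSlackThesis` (stmt-RiemannHypothesis-18180): summit equivalence,
the route's conjunct split, and the typed decomposition / strengthening candidates of STRATEGY-CENSUS.md

Everything here is PROVED (no `sorry`); every `def` is a candidate piece referred to by the census.

§1  `slackThesis_iff_summit` — the C → S and S → C probes both SUCCEED: X♭ ≡ RH in the tree
    (→ : the route's own `closes`, i.e. W-MAG `Theorems.ConeMagnification_proof` at `c := Λ`;
     ← : `WeilPositivity.of_riemannHypothesis explicit_formula_holds` and `-∫‖g‖² ≤ 0`).
§2  The route's conjunct split `WeilposSlackRungLog2 ∧ SlackResidualLog2`: both pieces are RH-corollaries,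
    the conjunction is RH, and GIVEN THE RUNG the residual IS RH (`residual_iff_summit_of_rung`).
§3  Decomposition candidates: D1 cutoff split (tail piece ≡ X♭, `beyond_iff_summit`); D2 parity split
    (assembly proved; the EXACT parity faces are each summit-equivalent IN THE TREE:
    `summit_of_exactOddReal`, `summit_of_exactEvenReal`); D4 zero-location split (assembly proved; pieces
    have no plan and are foreign to the route's lever); D3 / S⁺ candidates typed for the census.
-/

noncomputable section

set_option linter.dupNamespace false

namespace Summit.RiemannHypothesis.RiemannHypothesis.Cruxes.WeilposSlackThesis.StrategistR1

open Summit.RiemannHypothesis.RiemannHypothesis.Theses.WeilPos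
open Literature.NumberTheory.LFunctions MeasureTheory Set

/-! ## §1  The probes `C → S` and `S → C` both succeed -/

/-- Under RH the unit-slack inequality holds for EVERY test function (no support or cutoff needed). -/
theorem slack_of_summit (hRH : _root_.Summit.RiemannHypothesis) (g : ℝ → ℂ) (hg : IsWeilTest g) :
    -(∫ t, ‖g t‖ ^ 2) ≤ (weilQuadratic g).re := by
  have h0 : 0 ≤ (weilQuadratic g).re :=
    WeilPositivity.of_riemannHypothesis explicit_formula_holds hRH g hg
  have h1 : 0 ≤ ∫ t, ‖g t‖ ^ 2 := integral_nonneg fun t => by positivity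
  linarith

/-- `C → S` SUCCEEDS: the crux implies the summit — this is the route's own deciding theorem `closes`
(W-MAG at `c := Λ`), with its residual binder discharged by the identity. -/
theorem summit_of_slackThesis (hS : WeilposSlackThesis) : _root_.Summit.RiemannHypothesis :=
  closes (fun g hg hs => hS _ (Real.log_pos one_lt_two) g hg hs) (fun _ => hS)

/-- `S → C` SUCCEEDS: the summit implies the crux (easy half of Weil's criterion + `-‖g‖² ≤ 0`). -/
theorem slackThesis_of_summit (hRH : _root_.Summit.RiemannHypothesis) : WeilposSlackThesis :=
  fun _ _ g hg _ => slack_of_summit hRH g hg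

/-- **The crux is the summit in costume**: `WeilposSlackThesis ↔ RiemannHypothesis`, kernel-checked
over landed declarations only. -/
theorem slackThesis_iff_summit : WeilposSlackThesis ↔ _root_.Summit.RiemannHypothesis :=
  ⟨summit_of_slackThesis, slackThesis_of_summit⟩

/-- … and it is the EXACT face (aside `WeilposThesis`, Weil's criterion) in costume too. -/
theorem slackThesis_iff_exactThesis : WeilposSlackThesis ↔ WeilposThesis :=
  slackThesis_iff_summit.trans riemannHypothesis_iff_forall_weilPositivityOn

/-! ## §2  The route's conjunct split `Rung ∧ (Rung → X♭)` -/

/-- The attacked conjunct (first slack rung, cutoff `log 2`) is an RH-corollary. -/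
theorem rung_of_summit (hRH : _root_.Summit.RiemannHypothesis) : WeilposSlackRungLog2 :=
  fun g hg _ => slack_of_summit hRH g hg

/-- The declared residual is an RH-corollary. -/
theorem residual_of_summit (hRH : _root_.Summit.RiemannHypothesis) : SlackResidualLog2 :=
  fun _ => slackThesis_of_summit hRH

/-- GIVEN THE RUNG (the route's planned finite certificate), the residual IS the summit. -/
theorem residual_iff_summit_of_rung (hR : WeilposSlackRungLog2) :
    SlackResidualLog2 ↔ _root_.Summit.RiemannHypothesis :=
  ⟨fun hRes => closes hR hRes, residual_of_summit⟩

/-- The conjunction of the two load-bearing binders of `closes` is exactly the summit. -/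
theorem rung_and_residual_iff_summit :
    (WeilposSlackRungLog2 ∧ SlackResidualLog2) ↔ _root_.Summit.RiemannHypothesis :=
  ⟨fun h => closes h.1 h.2, fun h => ⟨rung_of_summit h, residual_of_summit h⟩⟩

/-- The crux trivially gives the rung, so the residual is `Rung → X♭` with `X♭ → Rung` free:
the residual carries the whole of X♭ beyond one finite computation. -/
theorem rung_of_slackThesis (hS : WeilposSlackThesis) : WeilposSlackRungLog2 :=
  fun g hg hs => hS _ (Real.log_pos one_lt_two) g hg hs

/-! ## §3  Decomposition candidates -/

/-! ### D1 — cutoff split `a ≤ A` ∧ `a > A` -/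

/-- D1, lower piece: unit-slack positivity at every cutoff `a ≤ A` (a finite rung; certifiable). -/
def SlackUpTo (A : ℝ) : Prop :=
  ∀ a : ℝ, 0 < a → a ≤ A → ∀ g : ℝ → ℂ, IsWeilTest g → tsupport g ⊆ Icc (-a) a →
    -(∫ t, ‖g t‖ ^ 2) ≤ (weilQuadratic g).re

/-- D1, upper piece (the tail): unit-slack positivity at every cutoff `a > A`. -/
def SlackBeyond (A : ℝ) : Prop :=
  ∀ a : ℝ, A < a → ∀ g : ℝ → ℂ, IsWeilTest g → tsupport g ⊆ Icc (-a) a →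
    -(∫ t, ‖g t‖ ^ 2) ≤ (weilQuadratic g).re

/-- D1 assembly (trivial seam). -/
theorem slackThesis_of_upTo_of_beyond (A : ℝ) (h₁ : SlackUpTo A) (h₂ : SlackBeyond A) :
    WeilposSlackThesis := fun a ha g hg hs => by
  rcases le_or_gt a A with hA | hA
  · exact h₁ a ha hA g hg hs
  · exact h₂ a hA g hg hs

/-- D1 COLLAPSE: the tail ALONE is the whole crux (monotonicity in the cutoff). -/
theorem slackThesis_of_beyond (A : ℝ) (h₂ : SlackBeyond A) : WeilposSlackThesis :=
  fun a _ g hg hs => by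
  have hb : A < max a (A + 1) := lt_of_lt_of_le (lt_add_one A) (le_max_right _ _)
  refine h₂ (max a (A + 1)) hb g hg (hs.trans ?_)
  exact Icc_subset_Icc (neg_le_neg (le_max_left _ _)) (le_max_left _ _)

/-- Hence the tail piece is summit-equivalent for EVERY `A`: D1 fails (c). -/
theorem beyond_iff_summit (A : ℝ) : SlackBeyond A ↔ _root_.Summit.RiemannHypothesis :=
  ⟨fun h => summit_of_slackThesis (slackThesis_of_beyond A h),
    fun h _ _ g hg _ => slack_of_summit h g hg⟩

/-! ### D2 — parity split (Bombieri's `f = ± f*`, i.e. `g(-t) = ± g(t)` in the tree's dictionary) -/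

/-- D2, even piece: unit-slack positivity on EVEN tests at every cutoff. -/
def SlackEven : Prop :=
  ∀ a : ℝ, 0 < a → ∀ g : ℝ → ℂ, IsWeilTest g → (∀ t, g (-t) = g t) → tsupport g ⊆ Icc (-a) a →
    -(∫ t, ‖g t‖ ^ 2) ≤ (weilQuadratic g).re

/-- D2, odd piece: unit-slack positivity on ODD tests at every cutoff. -/
def SlackOdd : Prop :=
  ∀ a : ℝ, 0 < a → ∀ g : ℝ → ℂ, IsWeilTest g → (∀ t, g (-t) = -g t) → tsupport g ⊆ Icc (-a) a →
    -(∫ t, ‖g t‖ ^ 2) ≤ (weilQuadratic g).re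

/-- D2 assembly, PROVED: `Q(g) = Q(g_ev) + Q(g_od)` (`weilQuadratic_eq_evenPart_add_oddPart`) and
`‖g‖² = ‖g_ev‖² + ‖g_od‖²` (`integral_norm_sq_evenPart_add_oddPart`). -/
theorem slackThesis_of_even_of_odd (hE : SlackEven) (hO : SlackOdd) : WeilposSlackThesis := by
  intro a ha g hg hs
  have het : IsWeilTest fun t ↦ (g t + g (-t)) / 2 := hg.evenPart
  have hot : IsWeilTest fun t ↦ (g t - g (-t)) / 2 := hg.oddPart
  have hes : tsupport (fun t ↦ (g t + g (-t)) / 2) ⊆ Icc (-a) a :=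
    tsupport_subset_Icc_of_symm hs fun s h1 h2 ↦ by simp only [h1, h2, add_zero, zero_div]
  have hos : tsupport (fun t ↦ (g t - g (-t)) / 2) ⊆ Icc (-a) a :=
    tsupport_subset_Icc_of_symm hs fun s h1 h2 ↦ by simp only [h1, h2, sub_zero, zero_div]
  have heven : ∀ t, (fun t ↦ (g t + g (-t)) / 2) (-t) = (fun t ↦ (g t + g (-t)) / 2) t := by
    intro t
    simp only [neg_neg]
    ring
  have hodd : ∀ t, (fun t ↦ (g t - g (-t)) / 2) (-t) = -(fun t ↦ (g t - g (-t)) / 2) t := by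
    intro t
    simp only [neg_neg]
    ring
  have h1 := hE a ha _ het heven hes
  have h2 := hO a ha _ hot hodd hos
  have hQ : (weilQuadratic g).re =
      (weilQuadratic fun t ↦ (g t + g (-t)) / 2).re +
        (weilQuadratic fun t ↦ (g t - g (-t)) / 2).re := by
    rw [weilQuadratic_eq_evenPart_add_oddPart hg, Complex.add_re]
  have hN := integral_norm_sq_evenPart_add_oddPart hg
  rw [hQ, ← hN]
  linarith

/-- Both parity pieces are RH-corollaries. -/
theorem even_and_odd_of_summit (hRH : _root_.Summit.RiemannHypothesis) : SlackEven ∧ SlackOdd :=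
  ⟨fun _ _ g hg _ _ => slack_of_summit hRH g hg, fun _ _ g hg _ _ => slack_of_summit hRH g hg⟩

/-- D2, the EXACT odd face (no slack): Yoshida's odd-sector positivity, even restricted to REAL odd tests. -/
def ExactOddReal : Prop :=
  ∀ g : ℝ → ℂ, IsWeilTest g → (∀ t : ℝ, g (-t) = -g t) → (∀ t : ℝ, (g t).im = 0) →
    0 ≤ (weilQuadratic g).re

/-- D2, the EXACT even face restricted to real even tests. -/
def ExactEvenReal : Prop :=
  ∀ g : ℝ → ℂ, IsWeilTest g → (∀ t : ℝ, g (-t) = g t) → (∀ t : ℝ, (g t).im = 0) →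
    0 ≤ (weilQuadratic g).re

private theorem summit_of_lineOrReal
    (h : ∀ s : ℂ, riemannZeta s = 0 → 0 < s.re → s.re < 1 → s.re = 1 / 2 ∨ s.im = 0) :
    _root_.Summit.RiemannHypothesis :=
  -- tree: `ExactFirstBand ↔ RiemannHypothesis` (no real zeros of `ζ` in `(0,1)` + strip form of RH)
  _root_.Summit.RiemannHypothesis.Cruxes.ExactFirstBand.Negative.exactFirstBand_iff_riemannHypothesis.1 h

/-- D2 COLLAPSE (exact face), KERNEL-CHECKED: odd-sector positivity on real odd tests ALONE is the summit
(tree: `RuelleBandExactFirstBand.stub_oddSectorCriterion` + no real zeros in `(0,1)` + strip form of RH;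
print: Yoshida 1992 Prop. 1(1)). -/
theorem summit_of_exactOddReal (h : ExactOddReal) : _root_.Summit.RiemannHypothesis :=
  summit_of_lineOrReal
    (_root_.Summit.RiemannHypothesis.RiemannHypothesis.Theorems.RuelleBandExactFirstBand.stub_oddSectorCriterion h)

/-- D2 COLLAPSE (exact face), KERNEL-CHECKED: even-sector positivity on real even tests ALONE is the
summit (tree: `stub_evenCriterion_iff`; print: Yoshida 1992 Prop. 1(2) + `ζ(σ) ≠ 0` on `(0,1)`). -/
theorem summit_of_exactEvenReal (h : ExactEvenReal) : _root_.Summit.RiemannHypothesis :=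
  summit_of_lineOrReal
    (_root_.Summit.RiemannHypothesis.RiemannHypothesis.Theorems.RuelleBandExactFirstBand.stub_evenCriterion_iff.1 h)

theorem exactOddReal_iff_summit : ExactOddReal ↔ _root_.Summit.RiemannHypothesis :=
  ⟨summit_of_exactOddReal, fun h g hg _ _ =>
    WeilPositivity.of_riemannHypothesis explicit_formula_holds h g hg⟩

theorem exactEvenReal_iff_summit : ExactEvenReal ↔ _root_.Summit.RiemannHypothesis :=
  ⟨summit_of_exactEvenReal, fun h g hg _ _ =>
    WeilPositivity.of_riemannHypothesis explicit_formula_holds h g hg⟩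

/-! ### D3 — Bombieri's trichotomy (Rend. Lincei 2000, Cor. p. 37): typed pieces only
(the assembly is Bombieri's Thm 11, not in the tree). -/

/-- D3 piece: only finitely many zeros of `ζ` in the critical strip lie off the critical line. -/
def FinitelyManyOffLine : Prop :=
  {s : ℂ | riemannZeta s = 0 ∧ 0 < s.re ∧ s.re < 1 ∧ s.re ≠ 1 / 2}.Finite

theorem finitelyManyOffLine_of_summit (h : _root_.Summit.RiemannHypothesis) : FinitelyManyOffLine := by
  have hstrip := riemannHypothesis_iff_strip_holds.1 h
  have : {s : ℂ | riemannZeta s = 0 ∧ 0 < s.re ∧ s.re < 1 ∧ s.re ≠ 1 / 2} = ∅ := by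
    ext s
    simp only [mem_setOf_eq, mem_empty_iff_false, iff_false, not_and, ne_eq, not_not]
    exact fun hs h0 h1 => hstrip s hs h0 h1
  rw [FinitelyManyOffLine, this]
  exact finite_empty

/-! ### D4 — zero-location split: quasi-RH(θ) ∧ "no zeros with 1/2 < |re s - 1/2| + 1/2 ≤ θ" -/

/-- D4, far piece (symmetric quasi-RH): every strip zero has `|re s − 1/2| ≤ θ − 1/2`. -/
def NoZerosFar (θ : ℝ) : Prop :=
  ∀ s : ℂ, riemannZeta s = 0 → 0 < s.re → s.re < 1 → |s.re - 1 / 2| ≤ θ - 1 / 2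

/-- D4, near piece: strip zeros with `|re s − 1/2| ≤ θ − 1/2` are on the line. -/
def NoZerosNear (θ : ℝ) : Prop :=
  ∀ s : ℂ, riemannZeta s = 0 → 0 < s.re → s.re < 1 → |s.re - 1 / 2| ≤ θ - 1 / 2 → s.re = 1 / 2

/-- D4 assembly (trivial seam), PROVED. -/
theorem summit_of_far_of_near (θ : ℝ) (hfar : NoZerosFar θ) (hnear : NoZerosNear θ) :
    _root_.Summit.RiemannHypothesis :=
  riemannHypothesis_iff_strip_holds.2 fun s hs h0 h1 => hnear s hs h0 h1 (hfar s hs h0 h1)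

/-- … and D4 feeds the crux only THROUGH the summit (`RH → X♭`): the route's lever plays no part. -/
theorem slackThesis_of_far_of_near (θ : ℝ) (hfar : NoZerosFar θ) (hnear : NoZerosNear θ) :
    WeilposSlackThesis :=
  slackThesis_of_summit (summit_of_far_of_near θ hfar hnear)

/-! ### S⁺ — strengthenings typed for the census -/

/-- S2: strict spectral gap of the Weil form at every finite cutoff (`ε(a) > 0 ∀ a`). -/
def StrictGap : Prop := ∀ a : ℝ, 0 < a → 0 < weilGroundEnergy a

/-- S3: a cutoff-UNIFORM gap. -/
def UniformGap : Prop :=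
  ∃ c : ℝ, 0 < c ∧ ∀ a : ℝ, 0 < a → ∀ g : ℝ → ℂ, IsWeilTest g → tsupport g ⊆ Icc (-a) a →
    c * (∫ t, ‖g t‖ ^ 2) ≤ (weilQuadratic g).re

/-- S2 ⇒ exact face ⇒ summit (so S2 is at least the summit; in print RH ⇒ S2 as well). -/
theorem summit_of_strictGap (h : StrictGap) : _root_.Summit.RiemannHypothesis :=
  riemannHypothesis_iff_forall_weilPositivityOn.2 fun a ha =>
    (weilGroundEnergy_nonneg_iff_holds ha).1 (h a ha).le

/-- S3 ⇒ summit. -/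
theorem summit_of_uniformGap (h : UniformGap) : _root_.Summit.RiemannHypothesis := by
  obtain ⟨c, hc, h⟩ := h
  refine riemannHypothesis_iff_forall_weilPositivityOn.2 fun a ha g hg hs => ?_
  have h1 : 0 ≤ ∫ t, ‖g t‖ ^ 2 := integral_nonneg fun t => by positivity
  have := h a ha g hg hs
  nlinarith

end Summit.RiemannHypothesis.RiemannHypothesis.Cruxes.WeilposSlackThesis.StrategistR1

end
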